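import Summits.Ventures.MM22.Rank333.GF2ProfileRowsSub
import HarnessLib

/-!
# ω-census family (a) / cell pub-mm22, v4 (0′) glue at `S ≠ 0`: arbitrary coset representatives, row congruence, and the S-node symmetry layer relative to `K`

Cell `pub-mm22` (MatrixMultiplication venture; HOME `run/shared/lean/pub/pub-mm22/`; seat LIT-2 g9), topic
`Summits/Ventures/MM22` (generic in `⟨l,m,n⟩`).  HONEST FRAMING: checker PLUMBING, not a result and not a bound.
Companion of `GF2ProfileRowsSub.lean` (G1–G4) for the cell's per-orbit PROFILE-CERT lift objects at a sub-instance
`S_K` (p2: `494 @ 20`; frozen spec §3b S-nodes at `S ≠ 0`).  Two things are added.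

(A) ARBITRARY COSET REPRESENTATIVES.  `GF2ProfileRowsSub` produces representing profiles valued in a candidate list that
covers the forms on `S_K` in the sense of the tree's `coverB l m K cands`, which is tied to the PIVOT representatives
`reduceB K`.  A certificate may use another system of representatives modulo `span K` (p2's «evencomp» object for
`494 @ 20`: `R′ = {f : popcount (f ∧ 84) even}`, a `Stab(84)`-invariant complement, so that S-node generators act on
RAW patterns and p1's root checker is unchanged):
* `coverByB l m red cands` — executable cover test for ANY representative map `red` (`red g = 0` or `red g ∈ cands` for
  all `g < 2^(l m)`); with `hred : ∀ g, ∀ u ∈ S_K, form (red g) u = form g u` it yields `exists_represents_of_coverBy`;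
  `coverByB l m (reduceB K) = coverB l m K` (`coverByB_reduceB`); `form_xor_eq_of_mem` gives `hred` for maps of the
  shape `g ↦ g` / `g ↦ g ⊕ κ` (`κ ∈ K`);
* the assembly with `coverByB`: `cert_succ_of_noIndexProfile_sub_of_coverBy`, `cert_succ_of_noProfile_sub_of_coverBy`,
  `cert_succ_of_noValidAllSub_of_coverBy`, `cert_succ_of_noValidSetSub_of_coverBy`;
* row congruence: `cert_of_subOf_le` (`Cert A b → S_A ≤ S_B → Cert B b`, Wang 2026 Lemma 1 with the identity sandwich)
  and `cert_congr_last` (`Cert (K ++ [f]) b → (f' ≡ f on S_K) → Cert (K ++ [f']) b`), so relative singleton rows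
  stated for one system of representatives serve every other.

(B) S-NODES AT `S ≠ 0` (the hypothesis `hσ` of `validAllSub_comp` for the sandwich generators; Wang 2026 Lemma 1):
* `cert_preimRow_sub_pullB` / `validAllSub_comp_pullB` — for an invertible sandwich (`Pi P = 1`, `Q Qi = 1` as bit
  identities) whose pull-back FIXES `S_K` (`∀ κ ∈ K`, `X ↦ κ(P X Q)` vanishes on `S_K`), validity against all certified
  `K`-rows is preserved by the REDUCED action `κ ↦ reduceB K (pullB l m P Q κ)` (the reduction is free on `S_K`,
  `form_reduceB_eq`); transposed twins `cert_preimRow_sub_pullTB` / `validAllSub_comp_pullTB` (square first factor);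
* `cert_preimRow_sub_pullB_raw` / `validAllSub_comp_pullB_raw` (and `…pullTB_raw`) — the same with the RAW action
  `κ ↦ pullB l m P Q κ`, for generator-INVARIANT systems of representatives («evencomp»);
* `fixesB K σ` / `fixes_of_fixesB` — the executable test `∀ κ ∈ K, reduceB K (σ κ) = 0` for «the generator fixes
  `S_K`» (sound for every `K`; the full test when `K` is reduced-echelon), wrappers `…_of_fixesB`, and `reduceB_lt`.

CONVENTION (as in the root layer): the spec's «`f ↦ P·f·Q`» on coefficient patterns is `pullB l m Pᵀ Qᵀ`
(`ofBits_pullB`: `pullB l m P Q κ = Pᵀ·C_κ·Qᵀ`), and «`f ↦ P·fᵀ·Q`» is `pullTB`-shaped (`ofBits_pullTB`).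
-/

namespace Summit.Ventures.MM22.GF2Cert.Profile

open Summit.MatrixMultiplication.OmegaCensus.GF2RankLB
open Literature.Computability.AlgebraicComplexity
open Module Matrix

variable {l m n N : ℕ} {ι : Type*} [Fintype ι]

/-! ## Covering by an arbitrary representative map -/

/-- Executable cover test for a representative map `red`: every pattern `g < 2^(l m)` has `red g = 0` or
`red g ∈ cands`. -/
def coverByB (l m : ℕ) (red : ℕ → ℕ) (cands : List ℕ) : Bool :=
  allLT (fun g => red g == 0 || cands.contains (red g)) (2 ^ (l * m))

/-- The tree's `coverB` is the case `red = reduceB K`. -/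
theorem coverByB_reduceB (K cands : List ℕ) : coverByB l m (reduceB K) cands = coverB l m K cands := rfl

/-- A pattern changed by a constraint pattern of `K` defines the same form on `S_K`. -/
theorem form_xor_eq_of_mem {K : List ℕ} {κ : ℕ} (hκ : κ ∈ K) (g : ℕ) :
    ∀ u ∈ subOf l m K, form l m (g ^^^ κ) u = form l m g u := by
  intro u hu
  rw [form_xor, LinearMap.add_apply, (mem_constrSub.1 hu) _ (List.mem_map.2 ⟨κ, hκ, rfl⟩), add_zero]

/-- Soundness of `coverByB`: with a representative map agreeing with the identity on `S_K`, the candidate forms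
cover every form not vanishing on `S_K` (the covering hypothesis of Wang 2026 §6, tree `cover_of_forall_dual`). -/
theorem cover_of_coverByB {K cands : List ℕ} {red : ℕ → ℕ}
    (hred : ∀ g, ∀ u ∈ subOf l m K, form l m (red g) u = form l m g u) (h : coverByB l m red cands = true) :
    ∀ f : Module.Dual (ZMod 2) (subOf l m K), f ≠ 0 →
      ∃ i, ∃ a : ZMod 2, a ≠ 0 ∧ ∀ u, f u = a * candF l m cands i u := by
  apply cover_of_forall_dual
  rw [forall_dual_iff]
  intro κ hκ ⟨u, hu, hne⟩
  rw [coverByB, allLT_iff] at h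
  have hr := h κ hκ
  simp only [Bool.or_eq_true, beq_iff_eq] at hr
  rcases hr with hr | hr
  · exfalso
    apply hne
    rw [← hred κ u hu, hr, form_zero, LinearMap.zero_apply]
  · rw [List.contains_iff_mem] at hr
    obtain ⟨i, hi⟩ := List.get_of_mem hr
    refine ⟨i, 1, one_ne_zero, fun v hv => ?_⟩
    rw [one_mul, candF, List.getD_eq_getElem _ _ i.2, ← List.get_eq_getElem, hi]
    exact (hred κ v hv).symm

/-- **Representing profiles valued in any covering system of representatives.** -/
theorem exists_represents_of_coverBy {K cands : List ℕ} {red : ℕ → ℕ}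
    (hred : ∀ g, ∀ u ∈ subOf l m K, form l m (red g) u = form l m g u) (hcov : coverByB l m red cands = true)
    (β : BilinComp (psiK l m n K) ι) (hnz : ∀ i, β.f i ≠ 0) :
    ∃ idx : ι → Fin cands.length, Represents β fun i => cands.get (idx i) := by
  have hc := cover_of_coverByB (l := l) (m := m) hred hcov
  have h01 : ∀ a : ZMod 2, a ≠ 0 → a = 1 := by decide
  have key : ∀ i, ∃ j : Fin cands.length, ∀ u : subOf l m K,
      β.f i u = form l m (cands.get j) (u : Matrix (Fin l) (Fin m) (ZMod 2)) := by
    intro i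
    obtain ⟨j, a, ha, hj⟩ := hc (β.f i) (hnz i)
    refine ⟨j, fun u => ?_⟩
    rw [hj u, h01 a ha, one_mul, candF, List.getD_eq_getElem _ _ j.2, ← List.get_eq_getElem]
  choose idx hidx using key
  exact ⟨idx, hidx⟩

/-! ## The assembly with `coverByB` -/

/-- `cert_succ_of_noIndexProfile_sub` for an arbitrary covering system of representatives. -/
theorem cert_succ_of_noIndexProfile_sub_of_coverBy {N : ℕ} {K : List ℕ} (hN : Cert l m n K N)
    (rows : List (List ℕ × ℕ)) (hrows : ∀ r ∈ rows, Cert l m n (K ++ r.1) r.2) {red : ℕ → ℕ}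
    (hred : ∀ g, ∀ u ∈ subOf l m K, form l m (red g) u = form l m g u) (cands : List ℕ)
    (hcov : coverByB l m red cands = true)
    (hno : ∀ idx : Fin N → Fin cands.length, RowsOK N rows (fun i => cands.get (idx i)) → False) :
    Cert l m n K (N + 1) := by
  classical
  intro r β
  have hNr : N ≤ r := hN r β
  by_contra hlt
  have hrN : r = N := by omega
  subst hrN
  obtain ⟨idx, hidx⟩ := exists_represents_of_coverBy hred hcov β (f_ne_zero_of_cert hN β)
  exact hno idx (rowsOK_of_represents rows hrows β hidx)

/-- `cert_succ_of_noProfile_sub` for an arbitrary covering system of representatives. -/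
theorem cert_succ_of_noProfile_sub_of_coverBy {N : ℕ} {K : List ℕ} (hN : Cert l m n K N)
    (rows : List (List ℕ × ℕ)) (hrows : ∀ r ∈ rows, Cert l m n (K ++ r.1) r.2) {red : ℕ → ℕ}
    (hred : ∀ g, ∀ u ∈ subOf l m K, form l m (red g) u = form l m g u) (cands : List ℕ)
    (hcov : coverByB l m red cands = true)
    (hno : ∀ prof : Fin N → ℕ, (∀ i, prof i ∈ cands) → RowsOK N rows prof → False) :
    Cert l m n K (N + 1) :=
  cert_succ_of_noIndexProfile_sub_of_coverBy hN rows hrows hred cands hcov fun idx hok =>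
    hno _ (fun i => List.get_mem cands (idx i)) hok

/-- `cert_succ_of_noValidAllSub` for an arbitrary covering system of representatives. -/
theorem cert_succ_of_noValidAllSub_of_coverBy {N : ℕ} {K : List ℕ} (hN : Cert l m n K N) {red : ℕ → ℕ}
    (hred : ∀ g, ∀ u ∈ subOf l m K, form l m (red g) u = form l m g u) (cands : List ℕ)
    (hcov : coverByB l m red cands = true)
    (hno : ∀ prof : Fin N → ℕ, (∀ i, prof i ∈ cands) → ValidAllSub l m n K N prof → False) :
    Cert l m n K (N + 1) := by
  classical
  intro r β
  have hNr : N ≤ r := hN r β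
  by_contra hlt
  have hrN : r = N := by omega
  subst hrN
  obtain ⟨idx, hidx⟩ := exists_represents_of_coverBy hred hcov β (f_ne_zero_of_cert hN β)
  exact hno _ (fun i => List.get_mem cands (idx i)) (validAllSub_of_represents β hidx)

/-- `cert_succ_of_noValidSetSub` for an arbitrary covering system of representatives. -/
theorem cert_succ_of_noValidSetSub_of_coverBy {N : ℕ} {K : List ℕ} (hN : Cert l m n K N) {red : ℕ → ℕ}
    (hred : ∀ g, ∀ u ∈ subOf l m K, form l m (red g) u = form l m g u) (cands : List ℕ)
    (hcov : coverByB l m red cands = true) (hsingle : ∀ f ∈ cands, Cert l m n (K ++ [f]) (N - 1))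
    (hno : ∀ M : Finset ℕ, M.card = N → (∀ f ∈ M, f ∈ cands) →
      (∀ (L : List ℕ) (b : ℕ), Cert l m n (K ++ L) b → b + (M.filter fun f => f ∈ L).card ≤ N) → False) :
    Cert l m n K (N + 1) := by
  classical
  refine cert_succ_of_noValidAllSub_of_coverBy hN hred cands hcov fun prof hc hV => ?_
  have hinj : Function.Injective prof := injective_of_validAllSub hV fun i => hsingle _ (hc i)
  refine hno (profSet prof) (card_profSet hinj) (fun f hf => ?_) (fun L b hL => ?_)
  · obtain ⟨i, rfl⟩ := mem_profSet.1 hf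
    exact hc i
  · rw [← card_filter_mem_eq hinj L]
    exact hV L b hL

/-! ## Row congruence -/

/-- **A lower bound for a sub-problem bounds the super-problem**: `Cert A b` and `S_A ≤ S_B` give `Cert B b`
(restrict a computation on `S_B` to `S_A`; Wang 2026 Lemma 1 with the identity sandwich). -/
theorem cert_of_subOf_le {A B : List ℕ} {b : ℕ} (h : Cert l m n A b) (hle : subOf l m A ≤ subOf l m B) :
    Cert l m n B b := by
  classical
  intro r β
  obtain ⟨γ⟩ := BilinComp.exists_restrictAlong β hle ∅ (by simp)
  have hb := h _ γ
  simp only [Finset.card_empty, Nat.sub_zero, Fintype.card_fin] at hb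
  exact hb

/-- **Relative singleton rows are congruence-invariant**: if `f'` and `f` define the same form on `S_K`, then
`Cert (K ++ [f]) b` gives `Cert (K ++ [f']) b`. -/
theorem cert_congr_last {K : List ℕ} {f f' : ℕ} {b : ℕ}
    (hff' : ∀ u ∈ subOf l m K, form l m f' u = form l m f u) (h : Cert l m n (K ++ [f]) b) :
    Cert l m n (K ++ [f']) b := by
  refine cert_of_subOf_le h fun x hx => ?_
  have hxK : x ∈ subOf l m K := subOf_append_le_subOf l m K [f] hx
  refine mem_constrSub.2 fun κ' hκ' => ?_
  obtain ⟨κ, hκ, rfl⟩ := List.mem_map.1 hκ'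
  rcases List.mem_append.1 hκ with hκK | hκf
  · exact (mem_constrSub.1 hxK) _ (List.mem_map.2 ⟨κ, hκK, rfl⟩)
  · rw [List.mem_singleton.1 hκf, hff' x hxK]
    exact (mem_constrSub.1 hx) _ (List.mem_map.2 ⟨f, List.mem_append_right K (List.mem_singleton_self f), rfl⟩)


/-! ## Range of the reduction -/

/-- `reduceB K` keeps patterns below `2^s` when the constraint patterns are below `2^s`. -/
theorem reduceB_lt {s : ℕ} : ∀ (K : List ℕ), (∀ κ ∈ K, κ < 2 ^ s) → ∀ {v : ℕ}, v < 2 ^ s → reduceB K v < 2 ^ s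
  | [], _, v, hv => hv
  | κ :: K, hK, v, hv => by
    simp only [reduceB]
    refine reduceB_lt K (fun κ' hκ' => hK κ' (List.mem_cons_of_mem _ hκ')) ?_
    split
    · exact Nat.xor_lt_two_pow hv (hK κ List.mem_cons_self)
    · exact hv

/-! ## The sandwich `X ↦ P X Q` relative to `K` -/

/-- **Certificate transport, relative to `K`, along a sandwich fixing `S_K`** (Wang 2026, Lemma 1). -/
theorem cert_preimRow_sub_pullB {K : List ℕ} {P Pi Q Qi : ℕ} (hP : mulBits l l l Pi P = oneBits l)
    (hQ : mulBits m m m Q Qi = oneBits m)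
    (hK : ∀ κ ∈ K, ∀ u : subOf l m K, form l m (pullB l m P Q κ) (u : Matrix (Fin l) (Fin m) (ZMod 2)) = 0)
    {M : List ℕ} {b : ℕ} (h : Cert l m n (K ++ M) b) :
    Cert l m n (K ++ preimRow l m (fun κ => reduceB K (pullB l m P Q κ)) M) b := by
  intro r γ
  refine h r (γ.ofSandwichLE (ofBits l l P) (ofBits l l Pi) (ofBits m m Q) (ofBits m m Qi)
    (ofBits_eq_one_of_mulBits_eq hP) (ofBits_eq_one_of_mulBits_eq hQ) ?_)
  intro x hx
  have hxK : x ∈ subOf l m K := subOf_append_le_subOf l m K M hx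
  refine mem_constrSub.2 fun κ' hκ' => ?_
  obtain ⟨κ, hκ, rfl⟩ := List.mem_map.1 hκ'
  rw [form_sandwich]
  rcases List.mem_append.1 hκ with hκK | hκM
  · exact hK κ hκK ⟨x, hxK⟩
  · have hσ : reduceB K (pullB l m P Q κ) ∈ M := (mem_preimRow.1 hκM).2
    rw [← form_reduceB_eq K (pullB l m P Q κ) x hxK]
    exact (mem_constrSub.1 hx) _ (List.mem_map.2 ⟨_, List.mem_append_right K hσ, rfl⟩)

/-- **S-node generator at `S ≠ 0`, plain sandwich**: validity against all certified `K`-rows is preserved by the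
pattern action `κ ↦ reduceB K (pullB l m P Q κ)` of an invertible sandwich fixing `S_K`. -/
theorem validAllSub_comp_pullB {K : List ℕ} {P Pi Q Qi : ℕ} (hP : mulBits l l l Pi P = oneBits l)
    (hQ : mulBits m m m Q Qi = oneBits m)
    (hK : ∀ κ ∈ K, ∀ u : subOf l m K, form l m (pullB l m P Q κ) (u : Matrix (Fin l) (Fin m) (ZMod 2)) = 0)
    {prof : Fin N → ℕ} (hlt : ∀ i, prof i < 2 ^ (l * m)) (h : ValidAllSub l m n K N prof) :
    ValidAllSub l m n K N (fun i => reduceB K (pullB l m P Q (prof i))) :=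
  validAllSub_comp (fun κ => reduceB K (pullB l m P Q κ)) (fun _ _ hM => cert_preimRow_sub_pullB hP hQ hK hM) hlt h

/-! ## The transposed sandwich `X ↦ P Xᵀ Q` relative to `K` (square first factor) -/

/-- **Certificate transport, relative to `K`, along a transposed sandwich fixing `S_K`** (Wang 2026, Lemma 1 with
the transpose symmetry of §4.1). -/
theorem cert_preimRow_sub_pullTB {K : List ℕ} {P Pi Q Qi : ℕ} (hP : mulBits l l l Pi P = oneBits l)
    (hQ : mulBits l l l Q Qi = oneBits l)
    (hK : ∀ κ ∈ K, ∀ u : subOf l l K, form l l (pullTB l P Q κ) (u : Matrix (Fin l) (Fin l) (ZMod 2)) = 0)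
    {M : List ℕ} {b : ℕ} (h : Cert l l n (K ++ M) b) :
    Cert l l n (K ++ preimRow l l (fun κ => reduceB K (pullTB l P Q κ)) M) b := by
  intro r γ
  refine h r (γ.ofTransposeSandwichLE (ofBits l l P) (ofBits l l Pi) (ofBits l l Q) (ofBits l l Qi)
    (ofBits_eq_one_of_mulBits_eq hP) (ofBits_eq_one_of_mulBits_eq hQ) ?_)
  intro x hx
  have hxK : x ∈ subOf l l K := subOf_append_le_subOf l l K M hx
  refine mem_constrSub.2 fun κ' hκ' => ?_
  obtain ⟨κ, hκ, rfl⟩ := List.mem_map.1 hκ'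
  rw [form_sandwichT]
  rcases List.mem_append.1 hκ with hκK | hκM
  · exact hK κ hκK ⟨x, hxK⟩
  · have hσ : reduceB K (pullTB l P Q κ) ∈ M := (mem_preimRow.1 hκM).2
    rw [← form_reduceB_eq K (pullTB l P Q κ) x hxK]
    exact (mem_constrSub.1 hx) _ (List.mem_map.2 ⟨_, List.mem_append_right K hσ, rfl⟩)

/-- **S-node generator at `S ≠ 0`, transposed sandwich**: validity against all certified `K`-rows is preserved
by `κ ↦ reduceB K (pullTB l P Q κ)`. -/
theorem validAllSub_comp_pullTB {K : List ℕ} {P Pi Q Qi : ℕ} (hP : mulBits l l l Pi P = oneBits l)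
    (hQ : mulBits l l l Q Qi = oneBits l)
    (hK : ∀ κ ∈ K, ∀ u : subOf l l K, form l l (pullTB l P Q κ) (u : Matrix (Fin l) (Fin l) (ZMod 2)) = 0)
    {prof : Fin N → ℕ} (hlt : ∀ i, prof i < 2 ^ (l * l)) (h : ValidAllSub l l n K N prof) :
    ValidAllSub l l n K N (fun i => reduceB K (pullTB l P Q (prof i))) :=
  validAllSub_comp (fun κ => reduceB K (pullTB l P Q κ)) (fun _ _ hM => cert_preimRow_sub_pullTB hP hQ hK hM) hlt h


/-! ## Raw actions (no re-reduction): for generator-invariant systems of representatives -/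

/-- **Certificate transport, relative to `K`, along a sandwich fixing `S_K`, raw action**: a certified `K`-row
`Cert (K ++ M) b` certifies the `K`-row of all patterns `κ < 2^(l m)` with `pullB l m P Q κ ∈ M`. -/
theorem cert_preimRow_sub_pullB_raw {K : List ℕ} {P Pi Q Qi : ℕ} (hP : mulBits l l l Pi P = oneBits l)
    (hQ : mulBits m m m Q Qi = oneBits m)
    (hK : ∀ κ ∈ K, ∀ u : subOf l m K, form l m (pullB l m P Q κ) (u : Matrix (Fin l) (Fin m) (ZMod 2)) = 0)
    {M : List ℕ} {b : ℕ} (h : Cert l m n (K ++ M) b) :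
    Cert l m n (K ++ preimRow l m (pullB l m P Q) M) b := by
  intro r γ
  refine h r (γ.ofSandwichLE (ofBits l l P) (ofBits l l Pi) (ofBits m m Q) (ofBits m m Qi)
    (ofBits_eq_one_of_mulBits_eq hP) (ofBits_eq_one_of_mulBits_eq hQ) ?_)
  intro x hx
  have hxK : x ∈ subOf l m K := subOf_append_le_subOf l m K M hx
  refine mem_constrSub.2 fun κ' hκ' => ?_
  obtain ⟨κ, hκ, rfl⟩ := List.mem_map.1 hκ'
  rw [form_sandwich]
  rcases List.mem_append.1 hκ with hκK | hκM
  · exact hK κ hκK ⟨x, hxK⟩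
  · have hσ : pullB l m P Q κ ∈ M := (mem_preimRow.1 hκM).2
    exact (mem_constrSub.1 hx) _ (List.mem_map.2 ⟨_, List.mem_append_right K hσ, rfl⟩)

/-- **S-node generator at `S ≠ 0`, raw sandwich action** `κ ↦ pullB l m P Q κ`. -/
theorem validAllSub_comp_pullB_raw {K : List ℕ} {P Pi Q Qi : ℕ} (hP : mulBits l l l Pi P = oneBits l)
    (hQ : mulBits m m m Q Qi = oneBits m)
    (hK : ∀ κ ∈ K, ∀ u : subOf l m K, form l m (pullB l m P Q κ) (u : Matrix (Fin l) (Fin m) (ZMod 2)) = 0)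
    {prof : Fin N → ℕ} (hlt : ∀ i, prof i < 2 ^ (l * m)) (h : ValidAllSub l m n K N prof) :
    ValidAllSub l m n K N (fun i => pullB l m P Q (prof i)) :=
  validAllSub_comp (pullB l m P Q) (fun _ _ hM => cert_preimRow_sub_pullB_raw hP hQ hK hM) hlt h

/-- **Certificate transport, relative to `K`, along a transposed sandwich fixing `S_K`, raw action.** -/
theorem cert_preimRow_sub_pullTB_raw {K : List ℕ} {P Pi Q Qi : ℕ} (hP : mulBits l l l Pi P = oneBits l)
    (hQ : mulBits l l l Q Qi = oneBits l)
    (hK : ∀ κ ∈ K, ∀ u : subOf l l K, form l l (pullTB l P Q κ) (u : Matrix (Fin l) (Fin l) (ZMod 2)) = 0)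
    {M : List ℕ} {b : ℕ} (h : Cert l l n (K ++ M) b) :
    Cert l l n (K ++ preimRow l l (pullTB l P Q) M) b := by
  intro r γ
  refine h r (γ.ofTransposeSandwichLE (ofBits l l P) (ofBits l l Pi) (ofBits l l Q) (ofBits l l Qi)
    (ofBits_eq_one_of_mulBits_eq hP) (ofBits_eq_one_of_mulBits_eq hQ) ?_)
  intro x hx
  have hxK : x ∈ subOf l l K := subOf_append_le_subOf l l K M hx
  refine mem_constrSub.2 fun κ' hκ' => ?_
  obtain ⟨κ, hκ, rfl⟩ := List.mem_map.1 hκ'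
  rw [form_sandwichT]
  rcases List.mem_append.1 hκ with hκK | hκM
  · exact hK κ hκK ⟨x, hxK⟩
  · have hσ : pullTB l P Q κ ∈ M := (mem_preimRow.1 hκM).2
    exact (mem_constrSub.1 hx) _ (List.mem_map.2 ⟨_, List.mem_append_right K hσ, rfl⟩)

/-- **S-node generator at `S ≠ 0`, raw transposed action** `κ ↦ pullTB l P Q κ`. -/
theorem validAllSub_comp_pullTB_raw {K : List ℕ} {P Pi Q Qi : ℕ} (hP : mulBits l l l Pi P = oneBits l)
    (hQ : mulBits l l l Q Qi = oneBits l)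
    (hK : ∀ κ ∈ K, ∀ u : subOf l l K, form l l (pullTB l P Q κ) (u : Matrix (Fin l) (Fin l) (ZMod 2)) = 0)
    {prof : Fin N → ℕ} (hlt : ∀ i, prof i < 2 ^ (l * l)) (h : ValidAllSub l l n K N prof) :
    ValidAllSub l l n K N (fun i => pullTB l P Q (prof i)) :=
  validAllSub_comp (pullTB l P Q) (fun _ _ hM => cert_preimRow_sub_pullTB_raw hP hQ hK hM) hlt h

/-! ## Executable test for «the generator fixes `S_K`» -/

/-- Executable test: every constraint pattern of `K`, pulled back by `σ`, reduces to `0` modulo `K`. -/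
def fixesB (K : List ℕ) (σ : ℕ → ℕ) : Bool :=
  K.all fun κ => reduceB K (σ κ) == 0

/-- Soundness of `fixesB`: the pulled-back constraint forms vanish on `S_K`. -/
theorem fixes_of_fixesB {K : List ℕ} {σ : ℕ → ℕ} (h : fixesB K σ = true) :
    ∀ κ ∈ K, ∀ u : subOf l m K, form l m (σ κ) (u : Matrix (Fin l) (Fin m) (ZMod 2)) = 0 := by
  intro κ hκ u
  rw [fixesB, List.all_eq_true] at h
  have h0 : reduceB K (σ κ) = 0 := by simpa using h κ hκ
  rw [← form_reduceB_eq K (σ κ) (u : Matrix (Fin l) (Fin m) (ZMod 2)) u.2, h0, form_zero, LinearMap.zero_apply]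

/-- `validAllSub_comp_pullB` with the executable side conditions. -/
theorem validAllSub_comp_pullB_of_fixesB {K : List ℕ} {P Pi Q Qi : ℕ} (hP : mulBits l l l Pi P = oneBits l)
    (hQ : mulBits m m m Q Qi = oneBits m) (hK : fixesB K (pullB l m P Q) = true)
    {prof : Fin N → ℕ} (hlt : ∀ i, prof i < 2 ^ (l * m)) (h : ValidAllSub l m n K N prof) :
    ValidAllSub l m n K N (fun i => reduceB K (pullB l m P Q (prof i))) :=
  validAllSub_comp_pullB hP hQ (fixes_of_fixesB hK) hlt h

/-- `validAllSub_comp_pullTB` with the executable side conditions. -/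
theorem validAllSub_comp_pullTB_of_fixesB {K : List ℕ} {P Pi Q Qi : ℕ} (hP : mulBits l l l Pi P = oneBits l)
    (hQ : mulBits l l l Q Qi = oneBits l) (hK : fixesB K (pullTB l P Q) = true)
    {prof : Fin N → ℕ} (hlt : ∀ i, prof i < 2 ^ (l * l)) (h : ValidAllSub l l n K N prof) :
    ValidAllSub l l n K N (fun i => reduceB K (pullTB l P Q (prof i))) :=
  validAllSub_comp_pullTB hP hQ (fixes_of_fixesB hK) hlt h

/-- `validAllSub_comp_pullB_raw` with the executable side conditions. -/
theorem validAllSub_comp_pullB_raw_of_fixesB {K : List ℕ} {P Pi Q Qi : ℕ} (hP : mulBits l l l Pi P = oneBits l)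
    (hQ : mulBits m m m Q Qi = oneBits m) (hK : fixesB K (pullB l m P Q) = true)
    {prof : Fin N → ℕ} (hlt : ∀ i, prof i < 2 ^ (l * m)) (h : ValidAllSub l m n K N prof) :
    ValidAllSub l m n K N (fun i => pullB l m P Q (prof i)) :=
  validAllSub_comp_pullB_raw hP hQ (fixes_of_fixesB hK) hlt h

/-- `validAllSub_comp_pullTB_raw` with the executable side conditions. -/
theorem validAllSub_comp_pullTB_raw_of_fixesB {K : List ℕ} {P Pi Q Qi : ℕ} (hP : mulBits l l l Pi P = oneBits l)
    (hQ : mulBits l l l Q Qi = oneBits l) (hK : fixesB K (pullTB l P Q) = true)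
    {prof : Fin N → ℕ} (hlt : ∀ i, prof i < 2 ^ (l * l)) (h : ValidAllSub l l n K N prof) :
    ValidAllSub l l n K N (fun i => pullTB l P Q (prof i)) :=
  validAllSub_comp_pullTB_raw hP hQ (fixes_of_fixesB hK) hlt h

end Summit.Ventures.MM22.GF2Cert.Profile
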